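import Summits.Ventures.HodgeRepro2.FundamentalDomainExists
import Summits.Ventures.HodgeRepro2.BallQuotientMeasure
import Summits.Ventures.HodgeRepro2.BallQuotientCovering

/-!
# A Borel fundamental domain for a torsion-free arithmetic group acting on the ball

Kernel support for the blind cell pub-hodge-repro2 (seat p2), T5-ID §ID-4(b′).  `BallQuotientMeasure.lean`
descended the Bergman measure to `Γ\𝔹²` through a fundamental domain `D` taken as a hypothesis
(`IsBallFundamentalDomain hQ S hS D`).  This file PROVES the hypothesis for every torsion-free subgroup
`S` of a Shimura congruence group `Γ_N` (for the Picard data of `Hypothesis.lean`): the frame action of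
`S` on `𝔹²` is properly discontinuous (row 71) and free (row 72), `𝔹²` is locally compact, Hausdorff and
second countable, so the general theorem of `FundamentalDomainExists.lean` applies.

What remains a hypothesis downstream is only the FINITENESS of `μ_B(D)` (finite covolume / compactness).
-/

namespace Summit.Ventures.HodgeRepro2.ShimuraData

open MeasureTheory

/-- The ball is non-empty (it contains the origin). -/
instance nonempty_ball₂ : Nonempty ball₂ := ⟨⟨0, zero_mem_ball₂⟩⟩

variable {K : Type*} [Field K] [NumberField K] [NumberField.IsCMField K]
    {τ₁ : K →+* ℂ} {H : Matrix (Fin 3) (Fin 3) K}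

/-- **Existence of a Borel fundamental domain on the ball.** For `H` hermitian, definite at every
place other than `τ₁`, a frame `Q`, a lattice `𝔪`, and a TORSION-FREE subgroup `S ⊆ Γ_N` of the Shimura
congruence group, there is a measurable set `D ⊆ 𝔹²` which is a fundamental domain for the frame
action of `S` with respect to the Bergman measure. -/
theorem exists_isBallFundamentalDomain (hH : IsHermitianForm K H)
    (hdef : ∀ τ : K →+* ℂ, NumberField.InfinitePlace.mk τ ≠ NumberField.InfinitePlace.mk τ₁ →
      IsDefiniteAt K τ H)
    {Q : Matrix (Fin 3) (Fin 3) ℂ} (hQ : IsFrame K τ₁ H Q) {𝔪 : Submodule ℤ (Fin 3 → K)}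
    (h𝔪 : IsLattice K 𝔪) {N : ℕ} {S : Subgroup (GL (Fin 3) K)} (hS : (S : Set (GL (Fin 3) K)) ⊆ shimuraLevel K H 𝔪 N)
    (htf : IsTorsionFreeSet K (S : Set (GL (Fin 3) K))) :
    ∃ D : Set ball₂, MeasurableSet D ∧
      IsBallFundamentalDomain hQ S (subset_unitaryGroup_of_subset_shimuraLevel hS) D := by
  letI := frameAction hQ S (subset_unitaryGroup_of_subset_shimuraLevel hS)
  haveI : ProperlyDiscontinuousSMul S ball₂ := properlyDiscontinuousSMul_frameAction hH hdef hQ h𝔪 hS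
  haveI : IsCancelSMul S ball₂ := isCancelSMul_frameAction_of_isTorsionFreeSet hH hdef hQ h𝔪 hS htf
  haveI : ContinuousConstSMul S ball₂ :=
    continuousConstSMul_frameAction hQ S (subset_unitaryGroup_of_subset_shimuraLevel hS)
  haveI : LocallyCompactSpace ball₂ := locallyCompactSpace_ball₂
  haveI : Countable S := countable_subgroup_GL_of_numberField S
  haveI : MeasurableConstSMul S ball₂ :=
    measurableConstSMul_frameAction hQ S (subset_unitaryGroup_of_subset_shimuraLevel hS)
  exact FundamentalDomainExists.exists_isFundamentalDomain_of_properlyDiscontinuousSMul bergmanBall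

/-- The same for the full congruence group `Γ_N` itself, `N > 2` (torsion-free by row 72's
`isCancelSMul_frameAction_shimuraLevel`). -/
theorem exists_isBallFundamentalDomain_shimuraLevel (hH : IsHermitianForm K H)
    (hdef : ∀ τ : K →+* ℂ, NumberField.InfinitePlace.mk τ ≠ NumberField.InfinitePlace.mk τ₁ →
      IsDefiniteAt K τ H)
    {Q : Matrix (Fin 3) (Fin 3) ℂ} (hQ : IsFrame K τ₁ H Q) {𝔪 : Submodule ℤ (Fin 3 → K)}
    (h𝔪 : IsLattice K 𝔪) {N : ℕ} (hN : 2 < N) :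
    ∃ D : Set ball₂, MeasurableSet D ∧
      IsBallFundamentalDomain hQ (shimuraLevelSubgroup K H 𝔪 N)
        (subset_unitaryGroup_of_subset_shimuraLevel (S := shimuraLevelSubgroup K H 𝔪 N)
          (N := N) (fun _ hγ => hγ)) D := by
  letI := frameAction hQ (shimuraLevelSubgroup K H 𝔪 N)
    (subset_unitaryGroup_of_subset_shimuraLevel (S := shimuraLevelSubgroup K H 𝔪 N) (N := N)
      (fun _ hγ => hγ))
  haveI : ProperlyDiscontinuousSMul (shimuraLevelSubgroup K H 𝔪 N) ball₂ :=
    properlyDiscontinuousSMul_frameAction hH hdef hQ h𝔪 (S := shimuraLevelSubgroup K H 𝔪 N) (N := N)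
      (fun _ hγ => hγ)
  haveI : IsCancelSMul (shimuraLevelSubgroup K H 𝔪 N) ball₂ :=
    isCancelSMul_frameAction_shimuraLevel hH hdef hQ h𝔪 hN
  haveI : ContinuousConstSMul (shimuraLevelSubgroup K H 𝔪 N) ball₂ :=
    continuousConstSMul_frameAction hQ _ _
  haveI : LocallyCompactSpace ball₂ := locallyCompactSpace_ball₂
  haveI : Countable (shimuraLevelSubgroup K H 𝔪 N) := countable_subgroup_GL_of_numberField _
  haveI : MeasurableConstSMul (shimuraLevelSubgroup K H 𝔪 N) ball₂ :=
    measurableConstSMul_frameAction hQ _ _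
  exact FundamentalDomainExists.exists_isFundamentalDomain_of_properlyDiscontinuousSMul bergmanBall

end Summit.Ventures.HodgeRepro2.ShimuraData
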